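import Summits.QuantumFields.YangMills.Theorems.BalabanUVNodesN19RateEdgeHolderD4AtLedgerReading
import Summits.QuantumFields.YangMills.Theorems.BalabanUVNodesN19RateEdgeHolderD4AtN16PinnedReading

/-!
# BalabanUVNodes ∕ N19 — K3⁷ v5's N19′ SLOT AT THE TRIMMED LEDGER READING: five IDLE ∃-bound letters of the ledger link reading (`…AtLedgerReading`, p613740)
# located and removed — `θc` (pinned at node U3's rate letter `R.u3.ρ`), `θ₃` (pinned at its N16-liaison floor `θ^(3β−2)`), `γ₃` and `l₁` (explicit), the dressed
# predicate `dressed` with its `DecidablePred` (read by no other row, so `⊥`): eleven rows, five letters and one instance binder OUT; what is left is NODE O's ledger world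
# proper — the run pins, the first-coupling recovery + selector, the (i) ledger obligation (now stated at the two rate floors), the ledger letters, (ii-m), N11's (iii),
# the (v′-16) N07 ∕ N16 rows that carry a letter of `R.ne3`, and the readings rows

Cell `pub-ymgap`, HUMAN RULING D-0062 (Track A), WIDTH SEAT `pub-ymgap-dag-n19-w3` (N19 NE7, seat 3 of 3), generation g4; bus CLAIM-1 ∕ INTENT-1.  Cluster item K3⁷
«SpineGivenEndpointR13SepCoPH» (stmt-QuantumFields-20544), plan's skeleton **v5 941dddb108cbaacf** (UNTOUCHED).  Filed `--kind proof --supports` that item `--as helper` (proves no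
registered stub).  COUNT-NEUTRAL.  THEOREMS ONLY; 0 `def`; 0 `sorry`; `N`-generic, guard-generic `G`, reading-generic `cr`; NO Theses import.  Imports this seat's g3
`…AtLedgerReading` (p613740) and `…AtN16PinnedReading` (p606117; only `rateCarriers_ne3_of_pinnedLoose` ∕ THE END's rows are read) — CITED BY NAME, not edited.

WHY THE FIVE LETTERS ARE IDLE (read off the 74-line binder `hlinkLedger` of p613740, copied verbatim into p614196 ∕ p618248 ∕ p618610).  (a) `θc` occurs ONLY in the row
`R.u3.ρ ≤ θc` and as the `θc` argument of `LedgerAtSync …` (its single field `rate_gt : max ω θc < L.θ'` is MONOTONE in `θc`) — the reading may as well display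
`θc := R.u3.ρ`.  (b) `θ₃` occurs ONLY in `θ^(3β−2) ≤ θ₃ ∧ θ₃ < 1` and as the last argument of `LedgerAtSync …` (field `θ₃_le : θ₃ ≤ L.θ'`, MONOTONE) — display
`θ₃ := θ^(3β−2)`; and `θ^(3β−2) < 1` is then a THEOREM of the kept rows `0 < θ ∧ θ⁶ = L⁻¹`, THE END's `2 ≤ L` (v5's key row `N16LettersEnd`, behind the loose pin) and stub 2's
own binder `2∕3 < β`.  (c) `γ₃`, `l₁` occur ONLY in `0 < γ₃ ∧ C·(wallConst·Nper²·(√(gradConst c')·dualC2 + 2b²·dualC1)) ≤ γ₃³ ∧ 0 < l₁ ∧ Λ₁ ≤ l₁³ ∧ γ₃θ² ≤ l₁·Nper` —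
five rows INHABITED OUTRIGHT by `γ₃ := max 1 (…)`, `l₁ := max 1 (max Λ₁ (γ₃θ²))` once `1 ≤ Nper` (THE END's regime row again).  (d) `dressed` (and its decidability
instance) is read by NO row except the dressed sub-ledger's three combinatorial rows, which hold at `dressed := ⊥` (`Finset.filter_false`, `0 ≤ S.vol`).  The N19′ edge's
conclusion `∃ δ, NE7.Core … δ ∧ Summable δ` is insensitive to the size of these letters, so nothing is lost: the converse (ledger reading ⇒ trimmed reading, by the
monotonicity of `LedgerAtSync` in `θc`, `θ₃`) is the sibling `…AtTrimmedLedgerReadingIff`; the face is EQUIVALENT at the two readings.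

WHAT THIS FILE PROVES (section hypothesis `hlinkTrim`, the TRIMMED LEDGER READING: versus `hlinkLedger` — 11 conjuncts, the binders `θc θ₃ γ₃ l₁ dressed` and one instance
binder OUT, (i) stated at `… R.u3.ω R.u3.ρ R.u3.θ (θ^(3β−2))`; versus v9 at any reading: 53 conjuncts and 11 binders out).
§1 ★★ `linkReadingAtLedgerReading_of_linkReadingAtTrimmedLedgerReading` — `hlinkTrim` + the loose pin `N16PinnedLoose 𝔯 ℓ₃ B` + THE END's rows `N16LettersEnd N g ℓ₃`
(v5's key) + `2∕3 < β` ⇒ p613740's `hlinkLedger` text VERBATIM (per tuple; the five letters re-inserted at the values above).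
§2 ★★ `h19HolderD4_datumOfRecord₁₃CoPH_of_linkReadingAtTrimmedLedgerReading_tuned` — N19′'s edge on tuned bare sequences at the trimmed reading (one application of
p613740 §2 at §1's reading).

HONEST FRAMING.  Count-neutral kernel bookkeeping (hygiene on this seat's own binder); `hlinkTrim` (NODE O's world; 0 instances) and `hdecT` are HYPOTHESES; the pins with
their letters and v5's N16 rows are v5's KEY (asserted for no reading); `D.Tuned` (K2⁷), the β-window (K1⁷) HYPOTHESES; `cr 𝔯 G ℓ ℓ₃ g B l₀ Λ` PARAMETERS.  NOT a proof of
`stub_expansion13H` or of K3⁷; no skeleton text touched; no guard row named.  NE7 NOT PRINTED ∕ NOT proved; nothing of Bałaban's asserted or instantiated (K0⁷ OPEN);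
N14 ∕ N16 ∕ N19 ∕ N22 NOT discharged; K3⁷ NOT claimed; counts unmoved (typed 28∕28 · discharged 5∕27 · A 5∕28).  One finite four-torus at fixed ε — R4 closes the
CONDITIONAL finite-𝕋⁴ rung `BalabanLadder.UV` only; NOT infinite volume ∕ OS ∕ mass gap; the YM mass gap (Clay) is NOT proved by any of this.  Standard axioms.  Edits nothing.
-/

set_option autoImplicit false

noncomputable section

open Finset MeasureTheory
open scoped BigOperators Matrix Matrix.Norms.L2Operator

namespace Summit.QuantumFields.YangMills.BalabanUVNodes.N19RateEdgeHolderD4AtTrimmedLedgerReading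

open Literature.MathematicalPhysics.QuantumFieldTheory.Balaban1983to89
open T4OutputRate T4RecentScale T4GoodClassBudget T4CauchySum T4TowerRateComposition T4TowerRateDischarge
open T4EtaRateMin (Readings NE3Shape)
open T4RateLiaison (GaugeDominated)
open FlowStep (RGEqH prefixOf)
open TreeLengthTorus (TFaceConnected torusTreeLen)
open B12TreeDecay (kappa₀)
open Summit.QuantumFields.BalabanUV.T4Continuum
open AveragingDeficitDualResidual (dualC1 dualC2)
open AveragingDeficitDerivWallProof (wallConst)
open AveragingDeficitPeriodicCounting (IsPeriodicDir)
open MinimalActionSandwich (IsMinimiser minAct)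
open MinimalActionRate (sfClass)
open MinimalActionRefine (RegularSup gradConst)
open NE3EnergyShapes (IsUnitarySite IsPeriodicSite)
open NE3.LeafIndexSockets (LeafH3sup)
open Summit.QuantumFields.BalabanUV.T4Continuum.Spine
open Summit.QuantumFields.BalabanUV.T4Continuum.Spine.NE4 (runFlow)
open Summit.QuantumFields.BalabanUV.T4Continuum.NE1p.DressedRoot (DressedTower DressedStabilityStrict)
open Summit.QuantumFields.YangMills.BalabanUVNodes.N19LedgerLinkSync (LedgerDataSync LedgerAtSync)
open YMDAG.UVSplit (SpineCarriers SpineRecordPred InputsPred U3Carriers RateCarriers RateRecordPred N14At N18At N22At ReadOutAt)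
open Summit.QuantumFields.YangMills.BalabanUVNodes.N16HolderDefs (CovRootHolder N16HolderAt)
open Summit.QuantumFields.YangMills.BalabanUVNodes.SpineRatesHolder (RatesHolderAt)
open Literature.MathematicalPhysics.QuantumFieldTheory.Balaban1983to89.T4Continuum (T4Family ULoop)
open YMDAG.UVSplit (Datum RateReading₁₃CoPH rateCarriersOfRecord₁₃CoPH ne3OfRecord₁₁)
open Node00 (Stage13HParams datumOfRecord₁₃CoPH SiteSeqKey NE3Letters₁₁ ne3ConstLayerOfRecord₁₁ ne3NperOfRecord₁₁ ne3DomOfRecord₁₁)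
open Summit.QuantumFields.YangMills.BalabanUVNodes.N16PinnedLayer13CoPH (N16PinnedLoose N16LettersEnd rateCarriers_ne3_of_pinnedLoose)
open YMDAG.N14.TopBorn (ne1OfRecord obsSupNorm)
open YMDAG.N14.TopBorn (obsSupNorm_nonneg)
open Node00 (U3Letters₁₁)
open Literature.MathematicalPhysics.QuantumFieldTheory.Balaban1983to89.Node00.U3OfKernels (objectsOfRecord₁₃)
open Summit.QuantumFields.YangMills.BalabanUVNodes.N19RateEdgeHolderD4AtLedgerReading (h19HolderD4_datumOfRecord₁₃CoPH_of_linkReadingAtLedgerReading_tuned)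

variable {N : ℕ} [NeZero N]

section AtTrimmedLedgerReading

variable
  (cr : (F : T4Family) → (θ : Stage13HParams F N) → θ.Provisos₁₃CoPH F N → (ℕ → ℝ) → List (ULoop F) → SpineCarriers)
  (𝔯 : RateReading₁₃CoPH N) (G : ∀ {F : T4Family}, Stage13HParams F N → Prop) {β : ℝ} (hβ1 : β ≤ 1)
  {ℓ₃ : T4Family → NE3Letters₁₁} {g B : T4Family → ℝ}
  (hlinkTrim : ∀ (F : T4Family) (θ : Stage13HParams F N) (hP : θ.Provisos₁₃CoPH F N), G θ → θ.Admissible F N →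
    ∀ (γ gIR b : ℝ) (g₀ : ℕ → ℝ), (datumOfRecord₁₃CoPH F N θ hP).Tuned γ gIR g₀ → γ ≤ θ.γ → γ ^ 2 ≤ Real.exp (-1) → 0 < b →
    (∀ K m, 0 ≤ m → m < K → b ≤ (datumOfRecord₁₃CoPH F N θ hP).βfun m (prefixOf (runFlow (datumOfRecord₁₃CoPH F N θ hP) g₀ K) m)) →
    ∀ (os : List (ULoop F)) (k : ℕ),
      let S : SpineCarriers := cr F θ hP g₀ os
      let R : RateCarriers N := rateCarriersOfRecord₁₃CoPH 𝔯 F θ hP g₀ os k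
      let D : Datum F N := datumOfRecord₁₃CoPH F N θ hP
      letI := S.dec
      ∃ (_ : DecidableEq R.u3.C.Dom) (F' : Type) (ι' X' : Type) (_ : MeasurableSpace ι')
        (L : LedgerDataSync R.u3.C F' ι' S.ι) (Rd : Readings ι' X') (bsel : (ℕ → ℝ) → ℝ) (EB : Functional R.u3.C R.u3.C.BgB)
        (g : ℕ → ℕ → ℝ)
        (uA : ℕ → ι' → R.u3.C.BgA) (uB : ℕ → ι' → R.u3.C.BgB)
        (Pf : ℕ → Params) (d₀ L₀ Koff : ℕ) (cells : (K j : ℕ) → R.u3.C.Dom → Finset (Site (Pf K) j))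
        (H033 : Flow → ℕ → Prop) (I : Type) (fam : I → B14.Sect2Data) (Lb βw : ℝ) (κ₁ : ℕ) (Gv Cl : ℝ) (K₁ : ℕ)
        (c' t θ : ℝ)
        (sel : ℕ → (B7Prop1Explicit.Site 4 → Fin 4 → (Matrix (Fin N) (Fin N) ℂ)ˣ) → (B7Prop1Explicit.Site 4 → Fin 4 → (Matrix (Fin N) (Fin N) ℂ)ˣ))
        (rd : ι' → (B7Prop1Explicit.Site 4 → Fin 4 → (Matrix (Fin N) (Fin N) ℂ)ˣ)),
        (∀ K i, i ≤ K → g K i = runFlow D g₀ K i) ∧ (∀ K i, K < i → g K i = gIR) ∧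
        EB = (fun s => R.u3.EB (bsel s) s) ∧
        (∀ (Sz : ℕ → ℝ → S.ι → ℕ → ℝ) (E₀ : ℝ) (m : ℕ) (a : ℝ) (Cw Λg : ℝ),
          (∀ K t, |t| ≤ S.l₀ → ∀ τ ∈ S.T K \ S.Bad K t, ∀ v ∈ Rd.dom, ∀ j ≤ K,
            |∑ X ∈ L.fac K t τ with R.u3.C.scale X = j,
                (Real.log (Real.exp (EB (fun i => g (K + 1) (i + 1)) (uB K v) X
                    - EB (fun i => g (K + 1) (i + 1)) L.oneB X))
                  - Real.log (Real.exp (R.u3.EA (g K) (uA K v) X - R.u3.EA (g K) L.oneA X)))| ≤ Sz K t τ j) →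
          0 ≤ E₀ → 0 < a → a < 1 →
          (∀ K t, |t| ≤ S.l₀ → ∀ τ ∈ S.T K \ S.Bad K t, ∀ j ≤ K,
            Sz K t τ j ≤ S.vol * (E₀ * ((K : ℝ) + 1) ^ m * a ^ (K - j))) →
          (∀ K, Multiplicity (L.All K) R.u3.C.scale (fun X => Real.exp (-(R.u3.κ * R.u3.C.d X))) Cw S.vol Λg K) →
          (∀ K t, |t| ≤ S.l₀ → ∀ τ ∈ S.T K \ S.Bad K t,
            WindowMultiplicity (L.facO K t τ) L.scO L.wO Cw S.vol Λg (jlogOf L.Cl K) K) →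
          1 ≤ Λg → L.θ' ≤ Λg →
          LedgerAtSync { L with S := Sz, E₀ := E₀, m := m, a := a, Cw := Cw, Λg := Λg } S.l₀ S.vol S.T S.Bad
            (fun K t τ => S.A K t τ - S.shA K t τ) (fun K t τ => S.B K t τ - S.shB K t τ) Rd R.u3.EA EB R.u3.κ g uA uB
            R.u3.ω R.u3.ρ R.u3.θ (θ ^ ((3 : ℝ) * β - 2))) ∧
        0 ≤ S.vol ∧
        (∀ K t, |t| ≤ S.l₀ → ∀ τ ∈ S.T K \ S.Bad K t,
          WindowMultiplicity (L.facO K t τ) L.scO L.wO L.Cw S.vol L.Λg (jlogOf L.Cl K) K) ∧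
        0 ≤ L.Cw ∧ 1 ≤ L.Λg ∧ L.θ' ≤ L.Λg ∧
        (∀ K, (Pf K).d = d₀) ∧ (∀ K, (Pf K).L = L₀) ∧ (∀ K, (Pf K).K = Koff + K) ∧
        (∀ K, (Fintype.card (Site (Pf K) (Pf K).K) : ℝ) = S.vol) ∧
        kappa₀ (4 * 2 ^ d₀) (2 * d₀) ≤ R.u3.κ ∧
        (∀ K, ∀ X ∈ L.All K,
          (cells K (R.u3.C.scale X + Koff) X).Nonempty ∧ TFaceConnected (cells K (R.u3.C.scale X + Koff) X)) ∧
        (∀ K j, Set.InjOn (cells K j) ↑((L.All K).filter fun X => R.u3.C.scale X + Koff = j)) ∧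
        (∀ K, ∀ X ∈ L.All K, torusTreeLen (cells K (R.u3.C.scale X + Koff) X) ≤ R.u3.C.d X) ∧
        B14.Thm2Printed H033 fam Lb βw κ₁ ∧ βw < 1 ∧ 0 < βw ∧ 1 < Lb ∧ 1 ≤ Gv ∧ 0 ≤ Cl ∧
        (∀ K t, |t| ≤ S.l₀ → ∀ τ ∈ S.T K \ S.Bad K t, ∀ j ≤ K, ∃ (i : I) (w : (fam i).Ω) (j' : ℕ),
          (fam i).flow.SatisfiesRG (fam i).K ∧ H033 (fam i).flow (fam i).K ∧ 1 ≤ j' ∧ j' ≤ (fam i).K ∧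
          (fam i).K - j' = K - j ∧ (fam i).K ≤ K + K₁ ∧
          (∀ n, 0 ≤ (fam i).gammaVol n w) ∧ (fam i).gammaVol (fam i).K w ≤ S.vol ∧
          (∀ n, n < (fam i).K → n < jlogOf Cl (fam i).K → (fam i).gammaVol n w = 0) ∧
          (∀ n, n < (fam i).K → jlogOf Cl (fam i).K ≤ n → (fam i).gammaVol n w ≤ S.vol * Gv ^ ((fam i).K - n))) ∧
        R.ne3.g = gradConst 4 c' ∧ 0 ≤ c' ∧ R.ne3.b ≤ t ∧ c' ≤ t ∧
        (2 : ℝ) ^ 91 * (R.ne3.L : ℝ) ^ 17 * t ≤ 1 ∧ (2 : ℝ) ^ 76 * (R.ne3.L : ℝ) ^ 12 * t ≤ R.ne3.ε ∧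
        16 * B7Prop2Explicit.C0 4 * R.ne3.ε ≤ 3 ∧ 1024 * (4 + 1) * (4 + 4) * (R.ne3.L : ℝ) ^ 2 * R.ne3.ε ≤ 1 ∧
        4 * ((ℓ₃ F).ε / B F) ≤ c' ∧
        LeafH3sup 4 R.ne3.L R.ne3.Nper R.ne3.ε R.ne3.b c' R.ne3.dom ∧
        (∀ V ∈ R.ne3.dom, ∀ k : ℕ, IsMinimiser 4 (sfClass 4 R.ne3.L R.ne3.Nper R.ne3.ε) R.ne3.L R.ne3.Nper k V (sel k V)) ∧
        (∀ V ∈ R.ne3.dom, ∀ k : ℕ, RegularSup 4 R.ne3.L R.ne3.Nper R.ne3.b c' k (sel k V)) ∧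
        0 < θ ∧ θ ^ 6 = ((R.ne3.L : ℝ))⁻¹ ∧
        (∀ v ∈ Rd.dom, rd v ∈ R.ne3.dom) ∧
        (∀ k, ∀ v ∈ Rd.dom, Rd.act k v = minAct 4 (sfClass 4 R.ne3.L R.ne3.Nper R.ne3.ε) R.ne3.L R.ne3.Nper k (rd v)) ∧
        (R.ne3.Nper : ℝ) ^ 4 ≤ Rd.vol ∧
        (∀ s ∈ Window γ, 0 < bsel s ∧ bsel s ≤ γ))

include hlinkTrim

/-! ## §1 The trimmed ledger reading (+ v5's loose pin and THE END's rows, `2∕3 < β`) IS the sibling's ledger reading -/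

/-- ★★ **THE TRIMMED LEDGER READING YIELDS THE LEDGER READING** [bookkeeping]: this file's displayed hypothesis `hlinkTrim` (the sibling's `hlinkLedger` with the five idle
letters `θc θ₃ γ₃ l₁ dressed`, one instance binder and eleven rows REMOVED, (i) at the floors `R.u3.ρ`, `θ^(3β−2)`) together with v5's loose N16 pin (`N16PinnedLoose 𝔯 ℓ₃ B`)
and THE END's rows (`N16LettersEnd N g ℓ₃`) — read ONLY for `1 ≤ R.ne3.Nper` and `2 ≤ R.ne3.L` — and stub 2's `2∕3 < β` yields the sibling's `hlinkLedger` text VERBATIM: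
`θc := R.u3.ρ` (`le_rfl`), `θ₃ := θ^(3β−2)` (`le_rfl`, and `θ^(3β−2) < 1` from `0 < θ`, `θ⁶ = L⁻¹`, `2 ≤ L`, `2∕3 < β`), `γ₃ := max 1 (C·(wallConst·Nper²·(…)))`,
`l₁ := max 1 (max Λ₁ (γ₃θ²))` (five rows by `le_max_…`, `le_self_pow₀`, `1 ≤ Nper`), `dressed := ⊥` (three rows by `Finset.filter_false`, `0 ≤ S.vol`); everything else
passed through.  Both readings are HYPOTHESES (0 instances); N16 ∕ N19 NOT discharged. -/
theorem linkReadingAtLedgerReading_of_linkReadingAtTrimmedLedgerReading (hβ23 : 2 / 3 < β) (hpin : N16PinnedLoose 𝔯 ℓ₃ B) (hend : N16LettersEnd N g ℓ₃) :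
    ∀ (F : T4Family) (θ : Stage13HParams F N) (hP : θ.Provisos₁₃CoPH F N), G θ → θ.Admissible F N →
    ∀ (γ gIR b : ℝ) (g₀ : ℕ → ℝ), (datumOfRecord₁₃CoPH F N θ hP).Tuned γ gIR g₀ → γ ≤ θ.γ → γ ^ 2 ≤ Real.exp (-1) → 0 < b →
    (∀ K m, 0 ≤ m → m < K → b ≤ (datumOfRecord₁₃CoPH F N θ hP).βfun m (prefixOf (runFlow (datumOfRecord₁₃CoPH F N θ hP) g₀ K) m)) →
    ∀ (os : List (ULoop F)) (k : ℕ),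
      let S : SpineCarriers := cr F θ hP g₀ os
      let R : RateCarriers N := rateCarriersOfRecord₁₃CoPH 𝔯 F θ hP g₀ os k
      let D : Datum F N := datumOfRecord₁₃CoPH F N θ hP
      letI := S.dec
      ∃ (_ : DecidableEq R.u3.C.Dom) (F' : Type) (ι' X' : Type) (_ : MeasurableSpace ι')
        (L : LedgerDataSync R.u3.C F' ι' S.ι) (Rd : Readings ι' X') (bsel : (ℕ → ℝ) → ℝ) (EB : Functional R.u3.C R.u3.C.BgB)
        (θc θ₃ : ℝ) (g : ℕ → ℕ → ℝ)
        (uA : ℕ → ι' → R.u3.C.BgA) (uB : ℕ → ι' → R.u3.C.BgB)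
        (Pf : ℕ → Params) (d₀ L₀ Koff : ℕ) (cells : (K j : ℕ) → R.u3.C.Dom → Finset (Site (Pf K) j))
        (H033 : Flow → ℕ → Prop) (I : Type) (fam : I → B14.Sect2Data) (Lb βw : ℝ) (κ₁ : ℕ) (Gv Cl : ℝ) (K₁ : ℕ)
        (dressed : R.u3.C.Dom → Prop) (_ : DecidablePred dressed)
        (c' t θ γ₃ l₁ : ℝ)
        (sel : ℕ → (B7Prop1Explicit.Site 4 → Fin 4 → (Matrix (Fin N) (Fin N) ℂ)ˣ) → (B7Prop1Explicit.Site 4 → Fin 4 → (Matrix (Fin N) (Fin N) ℂ)ˣ))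
        (rd : ι' → (B7Prop1Explicit.Site 4 → Fin 4 → (Matrix (Fin N) (Fin N) ℂ)ˣ)),
        (∀ K i, i ≤ K → g K i = runFlow D g₀ K i) ∧ (∀ K i, K < i → g K i = gIR) ∧
        EB = (fun s => R.u3.EB (bsel s) s) ∧
        (∀ (Sz : ℕ → ℝ → S.ι → ℕ → ℝ) (E₀ : ℝ) (m : ℕ) (a : ℝ) (Cw Λg : ℝ),
          (∀ K t, |t| ≤ S.l₀ → ∀ τ ∈ S.T K \ S.Bad K t, ∀ v ∈ Rd.dom, ∀ j ≤ K,
            |∑ X ∈ L.fac K t τ with R.u3.C.scale X = j,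
                (Real.log (Real.exp (EB (fun i => g (K + 1) (i + 1)) (uB K v) X
                    - EB (fun i => g (K + 1) (i + 1)) L.oneB X))
                  - Real.log (Real.exp (R.u3.EA (g K) (uA K v) X - R.u3.EA (g K) L.oneA X)))| ≤ Sz K t τ j) →
          0 ≤ E₀ → 0 < a → a < 1 →
          (∀ K t, |t| ≤ S.l₀ → ∀ τ ∈ S.T K \ S.Bad K t, ∀ j ≤ K,
            Sz K t τ j ≤ S.vol * (E₀ * ((K : ℝ) + 1) ^ m * a ^ (K - j))) →
          (∀ K, Multiplicity (L.All K) R.u3.C.scale (fun X => Real.exp (-(R.u3.κ * R.u3.C.d X))) Cw S.vol Λg K) →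
          (∀ K t, |t| ≤ S.l₀ → ∀ τ ∈ S.T K \ S.Bad K t,
            WindowMultiplicity (L.facO K t τ) L.scO L.wO Cw S.vol Λg (jlogOf L.Cl K) K) →
          1 ≤ Λg → L.θ' ≤ Λg →
          LedgerAtSync { L with S := Sz, E₀ := E₀, m := m, a := a, Cw := Cw, Λg := Λg } S.l₀ S.vol S.T S.Bad
            (fun K t τ => S.A K t τ - S.shA K t τ) (fun K t τ => S.B K t τ - S.shB K t τ) Rd R.u3.EA EB R.u3.κ g uA uB
            R.u3.ω θc R.u3.θ θ₃) ∧
        0 ≤ S.vol ∧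
        (∀ K t, |t| ≤ S.l₀ → ∀ τ ∈ S.T K \ S.Bad K t,
          WindowMultiplicity (L.facO K t τ) L.scO L.wO L.Cw S.vol L.Λg (jlogOf L.Cl K) K) ∧
        0 ≤ L.Cw ∧ 1 ≤ L.Λg ∧ L.θ' ≤ L.Λg ∧
        (∀ K, (Pf K).d = d₀) ∧ (∀ K, (Pf K).L = L₀) ∧ (∀ K, (Pf K).K = Koff + K) ∧
        (∀ K, (Fintype.card (Site (Pf K) (Pf K).K) : ℝ) = S.vol) ∧
        kappa₀ (4 * 2 ^ d₀) (2 * d₀) ≤ R.u3.κ ∧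
        (∀ K, ∀ X ∈ L.All K,
          (cells K (R.u3.C.scale X + Koff) X).Nonempty ∧ TFaceConnected (cells K (R.u3.C.scale X + Koff) X)) ∧
        (∀ K j, Set.InjOn (cells K j) ↑((L.All K).filter fun X => R.u3.C.scale X + Koff = j)) ∧
        (∀ K, ∀ X ∈ L.All K, torusTreeLen (cells K (R.u3.C.scale X + Koff) X) ≤ R.u3.C.d X) ∧
        B14.Thm2Printed H033 fam Lb βw κ₁ ∧ βw < 1 ∧ 0 < βw ∧ 1 < Lb ∧ 1 ≤ Gv ∧ 0 ≤ Cl ∧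
        (∀ K t, |t| ≤ S.l₀ → ∀ τ ∈ S.T K \ S.Bad K t, ∀ j ≤ K, ∃ (i : I) (w : (fam i).Ω) (j' : ℕ),
          (fam i).flow.SatisfiesRG (fam i).K ∧ H033 (fam i).flow (fam i).K ∧ 1 ≤ j' ∧ j' ≤ (fam i).K ∧
          (fam i).K - j' = K - j ∧ (fam i).K ≤ K + K₁ ∧
          (∀ n, 0 ≤ (fam i).gammaVol n w) ∧ (fam i).gammaVol (fam i).K w ≤ S.vol ∧
          (∀ n, n < (fam i).K → n < jlogOf Cl (fam i).K → (fam i).gammaVol n w = 0) ∧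
          (∀ n, n < (fam i).K → jlogOf Cl (fam i).K ≤ n → (fam i).gammaVol n w ≤ S.vol * Gv ^ ((fam i).K - n))) ∧
        (∀ K t, |t| ≤ S.l₀ → ∀ τ ∈ S.T K \ S.Bad K t,
          (∀ X ∈ (L.fac K t τ).filter (fun X => dressed X), R.u3.C.scale X = K) ∧
          ((L.fac K t τ).filter (fun X => dressed X)).card ≤ 1 ∧
          ((((L.fac K t τ).filter (fun X => dressed X)).card : ℝ) ≤ S.vol)) ∧
        R.ne3.g = gradConst 4 c' ∧ 0 ≤ c' ∧ R.ne3.b ≤ t ∧ c' ≤ t ∧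
        (2 : ℝ) ^ 91 * (R.ne3.L : ℝ) ^ 17 * t ≤ 1 ∧ (2 : ℝ) ^ 76 * (R.ne3.L : ℝ) ^ 12 * t ≤ R.ne3.ε ∧
        16 * B7Prop2Explicit.C0 4 * R.ne3.ε ≤ 3 ∧ 1024 * (4 + 1) * (4 + 4) * (R.ne3.L : ℝ) ^ 2 * R.ne3.ε ≤ 1 ∧
        4 * ((ℓ₃ F).ε / B F) ≤ c' ∧
        LeafH3sup 4 R.ne3.L R.ne3.Nper R.ne3.ε R.ne3.b c' R.ne3.dom ∧
        (∀ V ∈ R.ne3.dom, ∀ k : ℕ, IsMinimiser 4 (sfClass 4 R.ne3.L R.ne3.Nper R.ne3.ε) R.ne3.L R.ne3.Nper k V (sel k V)) ∧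
        (∀ V ∈ R.ne3.dom, ∀ k : ℕ, RegularSup 4 R.ne3.L R.ne3.Nper R.ne3.b c' k (sel k V)) ∧
        0 < θ ∧ θ ^ 6 = ((R.ne3.L : ℝ))⁻¹ ∧ 0 < γ₃ ∧
        R.ne3.C * (wallConst 4 R.ne3.L * (R.ne3.Nper : ℝ) ^ 2 *
          (Real.sqrt (gradConst 4 c') * dualC2 4 R.ne3.L + 2 * R.ne3.b ^ 2 * dualC1 4 R.ne3.L)) ≤ γ₃ ^ 3 ∧
        0 < l₁ ∧ R.ne3.Λ₁ ≤ l₁ ^ 3 ∧ γ₃ * θ ^ 2 ≤ l₁ * R.ne3.Nper ∧ θ ^ ((3 : ℝ) * β - 2) ≤ θ₃ ∧ θ₃ < 1 ∧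
        (∀ v ∈ Rd.dom, rd v ∈ R.ne3.dom) ∧
        (∀ k, ∀ v ∈ Rd.dom, Rd.act k v = minAct 4 (sfClass 4 R.ne3.L R.ne3.Nper R.ne3.ε) R.ne3.L R.ne3.Nper k (rd v)) ∧
        (R.ne3.Nper : ℝ) ^ 4 ≤ Rd.vol ∧
        R.u3.ρ ≤ θc ∧
        (∀ s ∈ Window γ, 0 < bsel s ∧ bsel s ≤ γ) := by
  intro F θ hP hG hθ γ gIR b g₀ ht hγle hγe hb0 hlow os k
  letI := (cr F θ hP g₀ os).dec
  obtain ⟨iDom, F', ι', X', iMeas, L, Rd, bsel, EB, gr, uA, uB, hrest⟩ := hlinkTrim F θ hP hG hθ γ gIR b g₀ ht hγle hγe hb0 hlow os k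
  obtain ⟨Pf, d₀, L₀, Koff, cells, H033, I, fam, Lb, βw, κ₁, Gv, Cl, K₁, c', t, ϑ, sel, rd, hrest⟩ := hrest
  obtain ⟨hgle, hggt, hEB, hL, hvol, homult, hCw, hΛg, hθΛ, hPd, hPL, hPK, hcard, hκ₀, hdom, hinj, hlen, hrest⟩ := hrest
  obtain ⟨h11, hβw1, hβw0, hLb, hGv, hCl, hfam, hrest⟩ := hrest
  obtain ⟨hg3, hc', hbt, hct, hsmall3, hεt, hε1, hε2, hε₁c, hH3, hsel, hreg, hθ0, hθ6, hrd, hact, hvol3, hbsel⟩ := hrest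
  -- THE END's regime rows behind the loose pin: `2 ≤ L`, `1 ≤ Nper`
  have hregE := (hend F).2.2.2.2.2.2
  have hL2 : 2 ≤ (rateCarriersOfRecord₁₃CoPH 𝔯 F θ hP g₀ os k).ne3.L := by
    rw [rateCarriers_ne3_of_pinnedLoose hpin F θ hP g₀ os k]; exact hregE.1
  have hN1 : 1 ≤ (rateCarriersOfRecord₁₃CoPH 𝔯 F θ hP g₀ os k).ne3.Nper := by
    rw [rateCarriers_ne3_of_pinnedLoose hpin F θ hP g₀ os k]; exact hregE.2.1
  have hL2r : (2 : ℝ) ≤ ((rateCarriersOfRecord₁₃CoPH 𝔯 F θ hP g₀ os k).ne3.L : ℝ) := by exact_mod_cast hL2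
  have hN1r : (1 : ℝ) ≤ ((rateCarriersOfRecord₁₃CoPH 𝔯 F θ hP g₀ os k).ne3.Nper : ℝ) := by exact_mod_cast hN1
  -- (b) the N16-liaison floor is below one
  have hϑ1 : ϑ < 1 := by
    by_contra hcon
    have h6 : (1 : ℝ) ≤ ϑ ^ 6 := one_le_pow₀ (not_lt.mp hcon)
    rw [hθ6] at h6
    have h2 : ((rateCarriersOfRecord₁₃CoPH 𝔯 F θ hP g₀ os k).ne3.L : ℝ)⁻¹ ≤ 1 / 2 := by
      rw [inv_eq_one_div]
      exact one_div_le_one_div_of_le (by norm_num) hL2r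
    linarith
  have hϑβ : ϑ ^ ((3 : ℝ) * β - 2) < 1 := Real.rpow_lt_one hθ0.le hϑ1 (by linarith)
  -- (c) the two explicit constants
  set W : ℝ := (rateCarriersOfRecord₁₃CoPH 𝔯 F θ hP g₀ os k).ne3.C *
      (wallConst 4 (rateCarriersOfRecord₁₃CoPH 𝔯 F θ hP g₀ os k).ne3.L * ((rateCarriersOfRecord₁₃CoPH 𝔯 F θ hP g₀ os k).ne3.Nper : ℝ) ^ 2 *
        (Real.sqrt (gradConst 4 c') * dualC2 4 (rateCarriersOfRecord₁₃CoPH 𝔯 F θ hP g₀ os k).ne3.L +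
          2 * (rateCarriersOfRecord₁₃CoPH 𝔯 F θ hP g₀ os k).ne3.b ^ 2 * dualC1 4 (rateCarriersOfRecord₁₃CoPH 𝔯 F θ hP g₀ os k).ne3.L)) with hW
  set γ₃ : ℝ := max 1 W with hγ₃
  set l₁ : ℝ := max 1 (max (rateCarriersOfRecord₁₃CoPH 𝔯 F θ hP g₀ os k).ne3.Λ₁ (γ₃ * ϑ ^ 2)) with hl₁
  have hγ₃1 : 1 ≤ γ₃ := le_max_left 1 W
  have hγ₃0 : 0 < γ₃ := one_pos.trans_le hγ₃1
  have hγ₃W : W ≤ γ₃ ^ 3 := (le_max_right 1 W).trans (le_self_pow₀ hγ₃1 (by norm_num))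
  have hl₁1 : 1 ≤ l₁ := le_max_left 1 _
  have hl₁0 : 0 < l₁ := one_pos.trans_le hl₁1
  have hΛl₁ : (rateCarriersOfRecord₁₃CoPH 𝔯 F θ hP g₀ os k).ne3.Λ₁ ≤ l₁ ^ 3 :=
    ((le_max_left _ _).trans (le_max_right 1 _)).trans (le_self_pow₀ hl₁1 (by norm_num))
  have hfit : γ₃ * ϑ ^ 2 ≤ l₁ * (rateCarriersOfRecord₁₃CoPH 𝔯 F θ hP g₀ os k).ne3.Nper :=
    ((le_max_right _ _).trans (le_max_right 1 _)).trans (le_mul_of_one_le_right hl₁0.le hN1r)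
  -- (d) the dressed sub-ledger at `dressed := ⊥`
  have hdress : ∀ K t, |t| ≤ (cr F θ hP g₀ os).l₀ → ∀ τ ∈ (cr F θ hP g₀ os).T K \ (cr F θ hP g₀ os).Bad K t,
      (∀ X ∈ (L.fac K t τ).filter (fun _ => False), (rateCarriersOfRecord₁₃CoPH 𝔯 F θ hP g₀ os k).u3.C.scale X = K) ∧
      ((L.fac K t τ).filter (fun _ => False)).card ≤ 1 ∧
      ((((L.fac K t τ).filter (fun _ => False)).card : ℝ) ≤ (cr F θ hP g₀ os).vol) := fun K t _ τ _ => by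
    simp only [Finset.filter_false, Finset.notMem_empty, false_imp_iff, imp_true_iff, Finset.card_empty, zero_le_one, Nat.cast_zero, true_and]
    exact hvol
  exact ⟨iDom, F', ι', X', iMeas, L, Rd, bsel, EB, (rateCarriersOfRecord₁₃CoPH 𝔯 F θ hP g₀ os k).u3.ρ, ϑ ^ ((3 : ℝ) * β - 2), gr, uA, uB, Pf, d₀, L₀,
    Koff, cells, H033, I, fam, Lb, βw, κ₁, Gv, Cl, K₁, fun _ => False, fun _ => instDecidableFalse, c', t, ϑ, γ₃, l₁, sel, rd, hgle, hggt, hEB, hL, hvol,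
    homult, hCw, hΛg, hθΛ, hPd, hPL, hPK, hcard, hκ₀, hdom, hinj, hlen, h11, hβw1, hβw0, hLb, hGv, hCl, hfam, hdress, hg3, hc', hbt, hct, hsmall3, hεt, hε1,
    hε2, hε₁c, hH3, hsel, hreg, hθ0, hθ6, hγ₃0, hγ₃W, hl₁0, hΛl₁, hfit, le_rfl, hϑβ, hrd, hact, hvol3, le_rfl, hbsel⟩

/-! ## §2 N19′'s edge on tuned bare sequences at the trimmed ledger reading -/

include hβ1 in
/-- ★★ **N19′'s EDGE ON TUNED BARE SEQUENCES AT THE TRIMMED LEDGER READING, ALL OF v5's OBJECT PINS, U3's SMALLNESS∕SIGN AND DECAY LETTER AS HYPOTHESES** [bookkeeping]: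
at every guarded admissible Stage-13 tuple, every bare sequence `g₀` TUNED to `gIR` within `]0, γ]` (`γ ≤ θ.γ`, `γ² ≤ e⁻¹`; [Balaban1987RG1] Thm 2 p. 259's condition — a
HYPOTHESIS), `b ≤ β ≤ b′` ALONG ITS RUNS OF RECORD with `0 < b` (K1⁷'s window; a HYPOTHESIS), every `os k`, GIVEN `0 < R.u3.ρ` and node U2's smallness window:
`PHolderD4 β D R → ∃ δ, NE7.Core (cr …) … δ ∧ Summable δ` — the sibling's `h19HolderD4_…AtLedgerReading_tuned` AT §1's reading (`2∕3 < β ≤ 1`).  NOT NE7;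
N14 ∕ N16 ∕ N19 ∕ N22 NOT discharged. -/
theorem h19HolderD4_datumOfRecord₁₃CoPH_of_linkReadingAtTrimmedLedgerReading_tuned (hβ23 : 2 / 3 < β)
    (hdecT : ∀ (F : T4Family) (θ : Stage13HParams F N) (hP : θ.Provisos₁₃CoPH F N), G θ → θ.Admissible F N → ∀ γ : ℝ, γ ≤ θ.γ →
      ∀ (g₀ : ℕ → ℝ) (os : List (ULoop F)) (k : ℕ), ∃ E₀ : ℝ, 0 ≤ E₀ ∧
        DecayBound (rateCarriersOfRecord₁₃CoPH 𝔯 F θ hP g₀ os k).u3.EA (Window γ) E₀ (rateCarriersOfRecord₁₃CoPH 𝔯 F θ hP g₀ os k).u3.κ)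
    {l₀ Λ : ℝ} (hl₀ : 0 ≤ l₀) (hΛ : 0 ≤ Λ) (hpin1 : ∀ (F : T4Family) (θ : Stage13HParams F N) (hP : θ.Provisos₁₃CoPH F N) (g₀ : ℕ → ℝ) (os : List (ULoop F)),
      𝔯.ne1 F θ hP g₀ os = ne1OfRecord l₀ Λ F θ hP g₀ os)
    (ℓ : (F : T4Family) → Stage13HParams F N → U3Letters₁₁)
    (hpinU3 : ∀ (F : T4Family) (θ : Stage13HParams F N) (hP : θ.Provisos₁₃CoPH F N) (g₀ : ℕ → ℝ) (os : List (ULoop F)),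
      (𝔯.lit F θ hP g₀ os).u3 = objectsOfRecord₁₃ F N θ.toStage13Params (ℓ F θ))
    (hpin : N16PinnedLoose 𝔯 ℓ₃ B) (hmatch : ∀ F : T4Family, 0 < B F ∧ (ℓ₃ F).ε / B F ≤ (ℓ₃ F).b) (hend : N16LettersEnd N g ℓ₃)
    (F : T4Family) (θ : Stage13HParams F N) (hP : θ.Provisos₁₃CoPH F N) (hG : G θ) (hθ : θ.Admissible F N) {γ gIR b' : ℝ} {g₀ : ℕ → ℝ}
    (ht : (datumOfRecord₁₃CoPH F N θ hP).Tuned γ gIR g₀) (hγle : γ ≤ θ.γ) (hγe : γ ^ 2 ≤ Real.exp (-1)) {b : ℝ} (hb0 : 0 < b)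
    (hlow : ∀ K m, 0 ≤ m → m < K →
      b ≤ (datumOfRecord₁₃CoPH F N θ hP).βfun m (prefixOf (runFlow (datumOfRecord₁₃CoPH F N θ hP) g₀ K) m))
    (halong : ∀ K i, i < K →
      (datumOfRecord₁₃CoPH F N θ hP).βfun i (prefixOf (runFlow (datumOfRecord₁₃CoPH F N θ hP) g₀ K) i) ≤ b')
    (os : List (ULoop F)) (k : ℕ) (hρ0 : 0 < (rateCarriersOfRecord₁₃CoPH 𝔯 F θ hP g₀ os k).u3.ρ)
    (hsmall : (rateCarriersOfRecord₁₃CoPH 𝔯 F θ hP g₀ os k).u3.cr * (rateCarriersOfRecord₁₃CoPH 𝔯 F θ hP g₀ os k).u3.C₉ *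
        (rateCarriersOfRecord₁₃CoPH 𝔯 F θ hP g₀ os k).u3.ω * (γ ^ 3 + 2 * γ / b) ≤ (1 - (rateCarriersOfRecord₁₃CoPH 𝔯 F θ hP g₀ os k).u3.ρ) / 2)
    (hP4 : RatesHolderAt (datumOfRecord₁₃CoPH F N θ hP) (rateCarriersOfRecord₁₃CoPH 𝔯 F θ hP g₀ os k) β ∧
      ReadOutAt (datumOfRecord₁₃CoPH F N θ hP) (rateCarriersOfRecord₁₃CoPH 𝔯 F θ hP g₀ os k).u3 ∧
      (0 ≤ (rateCarriersOfRecord₁₃CoPH 𝔯 F θ hP g₀ os k).u3.ρ ∧ (rateCarriersOfRecord₁₃CoPH 𝔯 F θ hP g₀ os k).u3.ρ < 1)) :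
    letI := (cr F θ hP g₀ os).dec
    ∃ δ : ℕ → ℝ, NE7.Core (cr F θ hP g₀ os).l₀ (cr F θ hP g₀ os).vol (cr F θ hP g₀ os).T (cr F θ hP g₀ os).Bad
      (fun K t τ => (cr F θ hP g₀ os).A K t τ - (cr F θ hP g₀ os).shA K t τ) (fun K t τ => (cr F θ hP g₀ os).B K t τ - (cr F θ hP g₀ os).shB K t τ) δ ∧
      Summable δ :=
  h19HolderD4_datumOfRecord₁₃CoPH_of_linkReadingAtLedgerReading_tuned cr 𝔯 G hβ1
    (linkReadingAtLedgerReading_of_linkReadingAtTrimmedLedgerReading cr 𝔯 G hlinkTrim hβ23 hpin hend) hdecT hl₀ hΛ hpin1 ℓ hpinU3 hpin hmatch hend F θ hP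
    hG hθ ht hγle hγe hb0 hlow halong os k hρ0 hsmall hP4

end AtTrimmedLedgerReading
end Summit.QuantumFields.YangMills.BalabanUVNodes.N19RateEdgeHolderD4AtTrimmedLedgerReading
end
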